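import Literature.Probability.LatticeModels.SixVertexGFFCorrelations

/-!
# Wick's rule for the GFF multi-point functions `Ψ_k^{GFF}` (DKLM 2026, Def. 2.6)

H. Duminil-Copin, K. K. Kozlowski, P. Lammers, I. Manolescu, *Gaussian free field convergence of
the six-vertex model with `-1 ≤ Δ ≤ -1/2`*, arXiv:2603.06268 (2026) [DKLM2026SixVertexGFF]:

> **Definition 2.6 (1).** `Ψ_k^{GFF}(u) = ∑_{a, π} (-1)^{ε(a)} ∏_{ij ∈ π} G_{ℝ²}(aᵢ, aⱼ)` […]
> These are precisely the correlation functions corresponding to a Gaussian process with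
> covariance `G_{ℝ²}`. (§1.2: "Wick's rule expresses `k`-point correlations in terms of products
> of `2`-point correlations".) (Part II §2.2, *Fusion asymptotics*:
> `Ψ_k(u) = Ψ_2(u₁,u₁',uᵢ,uᵢ') Ψ_{k-2}(((uⱼ,uⱼ'))_{j ∉ {1,i}}) + O(1)`.)

This file proves **Wick's rule** for `gffKPoint` of
`Literature/Probability/LatticeModels/SixVertexGFF.lean`: for `k = m + 2`,

  `Ψ_{m+2}^{GFF}(u) = ∑_{j ≠ 0} Ψ_2^{GFF}(u₀, u₀', uⱼ, uⱼ') · Ψ_m^{GFF}((uᵢ, uᵢ')_{i ∉ {0, j}})`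

(`gffKPoint_wick`), by splitting the sum over pairings `π` according to the partner `j = π(0)`
of the first index and relabelling the remaining indices increasingly (`skipPairEmb m j`, the
increasing enumeration of `Fin (m+2) ∖ {0, j}`; since it is increasing, the representatives
`i < π i` of the pairs correspond).

## References

* H. Duminil-Copin, K. K. Kozlowski, P. Lammers, I. Manolescu, arXiv:2603.06268 (2026), Def. 2.6,
  §1.2, Part II §2.2. [DKLM2026SixVertexGFF]
-/

noncomputable section

open Finset

namespace Literature.Probability.LatticeModels.SixVertex

variable {m : ℕ}

/-! ### Enumerating the complement of a pair `{0, j}` -/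

/-- The partner actually removed together with `0`: `j` itself, except that the degenerate value
`j = 0` is replaced by `1` (so that all definitions below are total). [folklore] -/
def partnerOf (j : Fin (m + 2)) : Fin (m + 2) := if j = 0 then 1 else j

/-- The removed partner is never `0`. [folklore] -/
theorem partnerOf_ne_zero (j : Fin (m + 2)) : partnerOf j ≠ 0 := by
  unfold partnerOf
  split_ifs with h
  · exact (Fin.zero_lt_one (n := m)).ne'
  · exact h

/-- For `j ≠ 0` the removed partner is `j`. [folklore] -/
theorem partnerOf_of_ne {j : Fin (m + 2)} (hj : j ≠ 0) : partnerOf j = j := if_neg hj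

/-- The cardinality of `Fin (m+2) ∖ {0, partner}`. [folklore] -/
theorem card_compl_pair (j : Fin (m + 2)) :
    (({0, partnerOf j} : Finset (Fin (m + 2)))ᶜ).card = m := by
  rw [Finset.card_compl, Finset.card_pair (partnerOf_ne_zero j).symm, Fintype.card_fin]
  omega

/-- **`skipPairEmb m j`**: the increasing enumeration `Fin m ↪o Fin (m+2)` of the indices other
than `0` and `j` (for `j ≠ 0`). [folklore] -/
def skipPairEmb (m : ℕ) (j : Fin (m + 2)) : Fin m ↪o Fin (m + 2) :=
  (({0, partnerOf j} : Finset (Fin (m + 2)))ᶜ).orderEmbOfFin (card_compl_pair j)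

/-- The enumeration hits exactly the indices other than `0` and the partner. [folklore] -/
theorem range_skipPairEmb (j : Fin (m + 2)) :
    Set.range (skipPairEmb m j) = ((({0, partnerOf j} : Finset (Fin (m + 2)))ᶜ : Finset _) : Set _) := by
  unfold skipPairEmb
  exact Finset.range_orderEmbOfFin _ _

/-- Enumerated indices are not `0`. [folklore] -/
theorem skipPairEmb_ne_zero (j : Fin (m + 2)) (i : Fin m) : skipPairEmb m j i ≠ 0 := by
  have h : skipPairEmb m j i ∈ Set.range (skipPairEmb m j) := ⟨i, rfl⟩
  rw [range_skipPairEmb] at h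
  simp only [Finset.coe_compl, Finset.coe_insert, Finset.coe_singleton, Set.mem_compl_iff,
    Set.mem_insert_iff, Set.mem_singleton_iff, not_or] at h
  exact h.1

/-- Enumerated indices are not the partner. [folklore] -/
theorem skipPairEmb_ne_partner (j : Fin (m + 2)) (i : Fin m) : skipPairEmb m j i ≠ partnerOf j := by
  have h : skipPairEmb m j i ∈ Set.range (skipPairEmb m j) := ⟨i, rfl⟩
  rw [range_skipPairEmb] at h
  simp only [Finset.coe_compl, Finset.coe_insert, Finset.coe_singleton, Set.mem_compl_iff,
    Set.mem_insert_iff, Set.mem_singleton_iff, not_or] at h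
  exact h.2

/-- Every index other than `0` and the partner is enumerated. [folklore] -/
theorem exists_skipPairEmb_eq {j : Fin (m + 2)} {x : Fin (m + 2)} (h0 : x ≠ 0)
    (hj : x ≠ partnerOf j) : ∃ i, skipPairEmb m j i = x := by
  have h : x ∈ Set.range (skipPairEmb m j) := by
    rw [range_skipPairEmb]
    simp [h0, hj]
  exact h

/-! ### The decomposition `Fin 2 ⊕ Fin m ≃ Fin (m+2)` adapted to the pair `{0, j}` -/

/-- `inl 0 ↦ 0`, `inl 1 ↦ j`, `inr i ↦ skipPairEmb m j i`. [folklore] -/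
def pairSumMap (m : ℕ) (j : Fin (m + 2)) : Fin 2 ⊕ Fin m → Fin (m + 2) :=
  Sum.elim (fun c => if c = 0 then 0 else partnerOf j) (skipPairEmb m j)

/-- `pairSumMap` is injective. [folklore] -/
theorem pairSumMap_injective (j : Fin (m + 2)) : Function.Injective (pairSumMap m j) := by
  rintro (c | i) (c' | i') h
  · simp only [pairSumMap, Sum.elim_inl] at h
    have hc : ∀ d : Fin 2, d = 0 ∨ d = 1 := fun d => by omega
    rcases hc c with rfl | rfl <;> rcases hc c' with rfl | rfl
    · rfl
    · simp only [if_true, Fin.one_eq_zero_iff, OfNat.ofNat_ne_one, if_false] at h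
      exact absurd h.symm (partnerOf_ne_zero j)
    · simp only [Fin.one_eq_zero_iff, OfNat.ofNat_ne_one, if_false, if_true] at h
      exact absurd h (partnerOf_ne_zero j)
    · rfl
  · simp only [pairSumMap, Sum.elim_inl, Sum.elim_inr] at h
    split_ifs at h
    · exact absurd h.symm (skipPairEmb_ne_zero j i')
    · exact absurd h.symm (skipPairEmb_ne_partner j i')
  · simp only [pairSumMap, Sum.elim_inl, Sum.elim_inr] at h
    split_ifs at h
    · exact absurd h (skipPairEmb_ne_zero j i)
    · exact absurd h (skipPairEmb_ne_partner j i)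
  · simp only [pairSumMap, Sum.elim_inr] at h
    rw [(skipPairEmb m j).injective h]

/-- `pairSumMap` is bijective (injective between types of equal cardinality). [folklore] -/
theorem pairSumMap_bijective (j : Fin (m + 2)) : Function.Bijective (pairSumMap m j) := by
  rw [Fintype.bijective_iff_injective_and_card]
  exact ⟨pairSumMap_injective j, by simp [add_comm]⟩

/-- The bijection `Fin 2 ⊕ Fin m ≃ Fin (m+2)` adapted to the pair `{0, j}`. [folklore] -/
def pairSumEquiv (m : ℕ) (j : Fin (m + 2)) : Fin 2 ⊕ Fin m ≃ Fin (m + 2) :=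
  Equiv.ofBijective _ (pairSumMap_bijective j)

/-- `inl 0 ↦ 0`. [folklore] -/
@[simp] theorem pairSumEquiv_inl_zero (j : Fin (m + 2)) : pairSumEquiv m j (Sum.inl 0) = 0 := by
  simp [pairSumEquiv, pairSumMap]

/-- `inl 1 ↦ partner`. [folklore] -/
@[simp] theorem pairSumEquiv_inl_one (j : Fin (m + 2)) :
    pairSumEquiv m j (Sum.inl 1) = partnerOf j := by
  simp [pairSumEquiv, pairSumMap]

/-- `inr i ↦ skipPairEmb m j i`. [folklore] -/
@[simp] theorem pairSumEquiv_inr (j : Fin (m + 2)) (i : Fin m) :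
    pairSumEquiv m j (Sum.inr i) = skipPairEmb m j i := by
  simp [pairSumEquiv, pairSumMap]

/-- `0 ↦ inl 0` under the inverse. [folklore] -/
@[simp] theorem pairSumEquiv_symm_zero (j : Fin (m + 2)) : (pairSumEquiv m j).symm 0 = Sum.inl 0 :=
  (pairSumEquiv m j).symm_apply_eq.mpr (pairSumEquiv_inl_zero j).symm

/-- `partner ↦ inl 1` under the inverse. [folklore] -/
@[simp] theorem pairSumEquiv_symm_partner (j : Fin (m + 2)) :
    (pairSumEquiv m j).symm (partnerOf j) = Sum.inl 1 :=
  (pairSumEquiv m j).symm_apply_eq.mpr (pairSumEquiv_inl_one j).symm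

/-- `skipPairEmb m j i ↦ inr i` under the inverse. [folklore] -/
@[simp] theorem pairSumEquiv_symm_skipPairEmb (j : Fin (m + 2)) (i : Fin m) :
    (pairSumEquiv m j).symm (skipPairEmb m j i) = Sum.inr i :=
  (pairSumEquiv m j).symm_apply_eq.mpr (pairSumEquiv_inr j i).symm


/-! ### Lifting a pairing of the remaining indices to a pairing with `0 ↔ j` -/

/-- The pairing of `Fin (m+2)` that pairs `0` with `j` and the remaining indices according to a
pairing `σ'` of `Fin m` (transported by `skipPairEmb`). [folklore] -/
def liftPairing (j : Fin (m + 2)) (σ' : Equiv.Perm (Fin m)) : Equiv.Perm (Fin (m + 2)) :=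
  (pairSumEquiv m j).permCongr (Equiv.sumCongr (Equiv.swap (0 : Fin 2) 1) σ')

/-- Unfolding `liftPairing`. [folklore] -/
theorem liftPairing_apply (j : Fin (m + 2)) (σ' : Equiv.Perm (Fin m)) (x : Fin (m + 2)) :
    liftPairing j σ' x =
      pairSumEquiv m j (Equiv.sumCongr (Equiv.swap (0 : Fin 2) 1) σ' ((pairSumEquiv m j).symm x)) :=
  rfl

/-- The lifted pairing pairs `0` with the partner. [folklore] -/
@[simp] theorem liftPairing_zero (j : Fin (m + 2)) (σ' : Equiv.Perm (Fin m)) :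
    liftPairing j σ' 0 = partnerOf j := by
  rw [liftPairing_apply, pairSumEquiv_symm_zero]
  simp

/-- The lifted pairing pairs the partner with `0`. [folklore] -/
@[simp] theorem liftPairing_partner (j : Fin (m + 2)) (σ' : Equiv.Perm (Fin m)) :
    liftPairing j σ' (partnerOf j) = 0 := by
  rw [liftPairing_apply, pairSumEquiv_symm_partner]
  simp

/-- On the remaining indices the lifted pairing is the transported pairing. [folklore] -/
@[simp] theorem liftPairing_skipPairEmb (j : Fin (m + 2)) (σ' : Equiv.Perm (Fin m)) (i : Fin m) :
    liftPairing j σ' (skipPairEmb m j i) = skipPairEmb m j (σ' i) := by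
  rw [liftPairing_apply, pairSumEquiv_symm_skipPairEmb]
  simp

/-- Every index is `0`, the partner, or an enumerated remaining index. [folklore] -/
theorem eq_zero_or_partner_or_skip (j : Fin (m + 2)) (x : Fin (m + 2)) :
    x = 0 ∨ x = partnerOf j ∨ ∃ i, x = skipPairEmb m j i := by
  by_cases h0 : x = 0
  · exact Or.inl h0
  by_cases hj : x = partnerOf j
  · exact Or.inr (Or.inl hj)
  obtain ⟨i, hi⟩ := exists_skipPairEmb_eq h0 hj
  exact Or.inr (Or.inr ⟨i, hi.symm⟩)

/-- The lift of a pairing is a pairing. [folklore] -/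
theorem liftPairing_mem_fpfInvolutions {j : Fin (m + 2)} {σ' : Equiv.Perm (Fin m)}
    (hσ' : σ' ∈ fpfInvolutions m) : liftPairing j σ' ∈ fpfInvolutions (m + 2) := by
  simp only [fpfInvolutions, Finset.mem_filter, Finset.mem_univ, true_and] at hσ' ⊢
  obtain ⟨hσσ, hfix⟩ := hσ'
  have hσσ' : ∀ i, σ' (σ' i) = i := fun i => by
    have := congrArg (fun ρ : Equiv.Perm (Fin m) => ρ i) hσσ
    simpa using this
  refine ⟨?_, fun x => ?_⟩
  · ext x
    simp only [Equiv.Perm.coe_mul, Function.comp_apply, Equiv.Perm.coe_one, id_eq]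
    rcases eq_zero_or_partner_or_skip j x with rfl | rfl | ⟨i, rfl⟩
    · rw [liftPairing_zero, liftPairing_partner]
    · rw [liftPairing_partner, liftPairing_zero]
    · rw [liftPairing_skipPairEmb, liftPairing_skipPairEmb, hσσ']
  · rcases eq_zero_or_partner_or_skip j x with rfl | rfl | ⟨i, rfl⟩
    · rw [liftPairing_zero]
      exact partnerOf_ne_zero j
    · rw [liftPairing_partner]
      exact (partnerOf_ne_zero j).symm
    · rw [liftPairing_skipPairEmb]
      exact fun h => hfix i ((skipPairEmb m j).injective h)

/-- Lifting pairings is injective. [folklore] -/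
theorem liftPairing_injective (j : Fin (m + 2)) : Function.Injective (liftPairing (m := m) j) := by
  intro σ₁ σ₂ h
  ext i
  have := congrArg (fun ρ : Equiv.Perm (Fin (m + 2)) => ρ (skipPairEmb m j i)) h
  simp only [liftPairing_skipPairEmb] at this
  exact congrArg Fin.val ((skipPairEmb m j).injective this)

/-- **Surjectivity**: every pairing of `Fin (m+2)` with `π(0) = j` is the lift of a pairing of the
remaining indices. [folklore] -/
theorem exists_liftPairing_eq {j : Fin (m + 2)} (hj : j ≠ 0) {σ : Equiv.Perm (Fin (m + 2))}
    (hσ : σ ∈ fpfInvolutions (m + 2)) (hσ0 : σ 0 = j) :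
    ∃ σ' ∈ fpfInvolutions m, liftPairing j σ' = σ := by
  simp only [fpfInvolutions, Finset.mem_filter, Finset.mem_univ, true_and] at hσ
  obtain ⟨hσσ, hfix⟩ := hσ
  have hσσ' : ∀ x, σ (σ x) = x := fun x => by
    have := congrArg (fun ρ : Equiv.Perm (Fin (m + 2)) => ρ x) hσσ
    simpa using this
  have hpj : partnerOf j = j := partnerOf_of_ne hj
  have hσj : σ (partnerOf j) = 0 := by rw [hpj, ← hσ0, hσσ']
  -- `σ` maps remaining indices to remaining indices
  have hrem : ∀ i : Fin m, ∃ i' : Fin m, skipPairEmb m j i' = σ (skipPairEmb m j i) := by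
    intro i
    refine exists_skipPairEmb_eq (fun h => ?_) (fun h => ?_)
    · have h2 := congrArg σ h
      rw [hσσ', hσ0] at h2
      exact skipPairEmb_ne_partner j i (h2.trans hpj.symm)
    · have h2 := congrArg σ h
      rw [hσσ', hσj] at h2
      exact skipPairEmb_ne_zero j i h2
  choose f hf using hrem
  have hff : ∀ i, f (f i) = i := fun i => by
    apply (skipPairEmb m j).injective
    rw [hf, hf, hσσ']
  have hfinj : Function.Injective f := fun i₁ i₂ h => by rw [← hff i₁, h, hff]
  let σ' : Equiv.Perm (Fin m) := ⟨f, f, hff, hff⟩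
  refine ⟨σ', ?_, ?_⟩
  · simp only [fpfInvolutions, Finset.mem_filter, Finset.mem_univ, true_and]
    refine ⟨?_, fun i h => ?_⟩
    · ext i
      exact congrArg Fin.val (hff i)
    · have := hf i
      change skipPairEmb m j (f i) = _ at this
      rw [show f i = i from h] at this
      exact hfix _ this.symm
  · ext x
    rcases eq_zero_or_partner_or_skip j x with rfl | rfl | ⟨i, rfl⟩
    · rw [liftPairing_zero, hpj, hσ0]
    · rw [liftPairing_partner, hσj]
    · rw [liftPairing_skipPairEmb]
      exact congrArg Fin.val (hf i)

/-! ### The representatives of the pairs of a lifted pairing -/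

/-- The representatives `x < π x` of the pairs of a lifted pairing: `0` together with the
enumerated representatives of the original pairing (the enumeration is increasing). [folklore] -/
theorem filter_lt_liftPairing {j : Fin (m + 2)} (hj : j ≠ 0) (σ' : Equiv.Perm (Fin m)) :
    (Finset.univ.filter fun x : Fin (m + 2) => x < liftPairing j σ' x) =
      insert 0 ((Finset.univ.filter fun i : Fin m => i < σ' i).map (skipPairEmb m j).toEmbedding) := by
  have hpj : partnerOf j = j := partnerOf_of_ne hj
  ext x
  simp only [Finset.mem_filter, Finset.mem_univ, true_and, Finset.mem_insert, Finset.mem_map,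
    RelEmbedding.coe_toEmbedding]
  rcases eq_zero_or_partner_or_skip j x with rfl | rfl | ⟨i, rfl⟩
  · simp only [liftPairing_zero, true_or, iff_true]
    exact Fin.pos_iff_ne_zero.mpr (partnerOf_ne_zero j)
  · simp only [liftPairing_partner, Fin.not_lt_zero, false_iff, not_or, not_exists, not_and]
    exact ⟨partnerOf_ne_zero j, fun i _ => skipPairEmb_ne_partner j i⟩
  · simp only [liftPairing_skipPairEmb, OrderEmbedding.lt_iff_lt, skipPairEmb_ne_zero, false_or]
    constructor
    · intro h
      exact ⟨i, h, rfl⟩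
    · rintro ⟨i', hi', h⟩
      rw [(skipPairEmb m j).injective h] at hi'
      exact hi'

/-! ### Wick's rule -/

/-- The two-point function as the signed sum over the four choices. [cite: DKLM2026SixVertexGFF, Def. 2.6] -/
theorem gffKPoint_two_eq_sum (v : Fin 2 → ℂ × ℂ) :
    gffKPoint 2 v = ∑ c : Fin 2 → Bool,
      (-1 : ℝ) ^ (Finset.univ.filter fun i => c i = true).card *
        greenPlane (pickPoint v c 0) (pickPoint v c 1) := by
  rw [gffKPoint, fpfInvolutions_two]
  have hfilt : (Finset.univ.filter fun i : Fin 2 => i < Equiv.swap (0 : Fin 2) 1 i) = {0} := by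
    decide
  simp only [Finset.sum_singleton, hfilt, Finset.prod_singleton, Equiv.swap_apply_left]

/-- **Wick's rule for `Ψ_k^{GFF}`** (Def. 2.6: "the correlation functions corresponding to a
Gaussian process with covariance `G_{ℝ²}`"; §1.2: Wick's rule): splitting the pairings by the
partner `j` of the index `0`,
`Ψ_{m+2}^{GFF}(u) = ∑_{j ≠ 0} Ψ_2^{GFF}(u₀, uⱼ) Ψ_m^{GFF}(u restricted to the other indices)`.
[cite: DKLM2026SixVertexGFF, Def. 2.6] -/
theorem gffKPoint_wick (u : Fin (m + 2) → ℂ × ℂ) :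
    gffKPoint (m + 2) u = ∑ j ∈ Finset.univ.erase (0 : Fin (m + 2)),
      gffKPoint 2 ![u 0, u j] * gffKPoint m (u ∘ skipPairEmb m j) := by
  classical
  -- Step 1: sum over pairings first, fibred by the partner of `0`
  conv_lhs => unfold gffKPoint
  rw [Finset.sum_comm]
  rw [← Finset.sum_fiberwise_of_maps_to (g := fun σ : Equiv.Perm (Fin (m + 2)) => σ 0)
    (t := Finset.univ.erase (0 : Fin (m + 2))) (fun σ hσ => by
      simp only [fpfInvolutions, Finset.mem_filter, Finset.mem_univ, true_and] at hσ
      exact Finset.mem_erase.mpr ⟨hσ.2 0, Finset.mem_univ _⟩)]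
  refine Finset.sum_congr rfl fun j hj => ?_
  have hj0 : j ≠ 0 := (Finset.mem_erase.mp hj).1
  have hpj : partnerOf j = j := partnerOf_of_ne hj0
  -- Step 2: reindex the fibre by pairings of the remaining indices
  rw [← Finset.sum_bij (s := fpfInvolutions m) (fun σ' _ => liftPairing j σ')
    (fun σ' hσ' => Finset.mem_filter.mpr ⟨liftPairing_mem_fpfInvolutions hσ', by
      rw [liftPairing_zero, hpj]⟩)
    (fun σ₁ _ σ₂ _ h => liftPairing_injective j h)
    (fun σ hσ => by
      obtain ⟨hσF, hσ0⟩ := Finset.mem_filter.mp hσ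
      obtain ⟨σ', hσ', h⟩ := exists_liftPairing_eq hj0 hσF hσ0
      exact ⟨σ', hσ', h⟩)
    (fun σ' _ => rfl)]
  -- Step 3: expand the right-hand side
  rw [gffKPoint_two_eq_sum, gffKPoint_eq_sum, Finset.sum_mul_sum]
  simp_rw [Finset.mul_sum]
  conv_rhs =>
    arg 2
    ext c
    rw [Finset.sum_comm]
  conv_rhs => rw [Finset.sum_comm]
  refine Finset.sum_congr rfl fun σ' hσ' => ?_
  -- now both sides are indexed by the choices; decompose `a ↔ (c, b)`
  set e := pairSumEquiv m j with he
  set A : (Fin (m + 2) → Bool) ≃ (Fin 2 → Bool) × (Fin m → Bool) :=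
    ((e.symm.arrowCongr (Equiv.refl Bool)).trans (Equiv.sumArrowEquivProdArrow (Fin 2) (Fin m) Bool))
    with hA
  rw [← Equiv.sum_comp A.symm, Fintype.sum_prod_type]
  refine Finset.sum_congr rfl fun c _ => Finset.sum_congr rfl fun b _ => ?_
  -- the reconstructed choice function and its values
  have hAsymm : ∀ x, A.symm (c, b) x = Sum.elim c b (e.symm x) := fun x => rfl
  have ha0 : A.symm (c, b) 0 = c 0 := by rw [hAsymm, he, pairSumEquiv_symm_zero]; rfl
  have haj : A.symm (c, b) j = c 1 := by
    have h := pairSumEquiv_symm_partner (m := m) j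
    rw [hpj] at h
    rw [hAsymm, he, h]
    rfl
  have hai : ∀ i, A.symm (c, b) (skipPairEmb m j i) = b i := fun i => by
    rw [hAsymm, he, pairSumEquiv_symm_skipPairEmb]; rfl
  -- sign
  have hsign : (Finset.univ.filter fun x => A.symm (c, b) x = true).card =
      (Finset.univ.filter fun i => c i = true).card + (Finset.univ.filter fun i => b i = true).card := by
    simp only [Finset.card_filter]
    rw [← Equiv.sum_comp e, Fintype.sum_sum_type, Fin.sum_univ_two, Fin.sum_univ_two]
    simp only [he, pairSumEquiv_inl_zero, pairSumEquiv_inl_one, hpj, pairSumEquiv_inr, ha0, haj, hai]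
  -- product over the representatives of the pairs
  have hprod : ∏ x ∈ Finset.univ.filter (fun x : Fin (m + 2) => x < liftPairing j σ' x),
      greenPlane (pickPoint u (A.symm (c, b)) x) (pickPoint u (A.symm (c, b)) (liftPairing j σ' x)) =
      greenPlane (pickPoint ![u 0, u j] c 0) (pickPoint ![u 0, u j] c 1) *
        ∏ i ∈ Finset.univ.filter (fun i : Fin m => i < σ' i),
          greenPlane (pickPoint (u ∘ skipPairEmb m j) b i)
            (pickPoint (u ∘ skipPairEmb m j) b (σ' i)) := by
    rw [filter_lt_liftPairing hj0 σ', Finset.prod_insert, Finset.prod_map]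
    · congr 1
      · rw [liftPairing_zero, hpj]
        simp only [pickPoint, ha0, haj]
        rfl
      · refine Finset.prod_congr rfl fun i _ => ?_
        simp only [RelEmbedding.coe_toEmbedding, liftPairing_skipPairEmb, pickPoint, hai,
          Function.comp_apply]
    · simp only [Finset.mem_map, Finset.mem_filter, Finset.mem_univ, true_and,
        RelEmbedding.coe_toEmbedding, not_exists, not_and]
      exact fun i _ => skipPairEmb_ne_zero j i
  rw [hsign, hprod, pow_add]
  ring

end Literature.Probability.LatticeModels.SixVertex

end
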